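import Summits.FinalStateConjecture.FinalStateConjecture.Theorems.SwallowTheDatumUniversalWitnessFamilyRegionOneHoleChart
import Summits.FinalStateConjecture.FinalStateConjecture.Theorems.EIHFluxBalanceInertialRecessionSchwarzschildFrame
import Literature.Geometry.Lorentzian.MultiCentreRadiationZone
import Literature.Geometry.Lorentzian.KerrHyperboloidalLeaves
import Literature.Geometry.Lorentzian.ChartCalculus

/-!
# Crux `SwallowTheDatum.UniversalWitnessFamily` (stmt-FinalStateConjecture-10051), line `Sketch`,
# stub `stub_regionOneDecomposition` — part 7: the flat (outgoing Kerr–Schild) chart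

The radiation-zone chart of the explicit `N = 1` decomposition of the Schwarzschild exterior
`Kerr.region 0 (2M)` (ingoing Kerr–Schild coordinates, metric `Kerr.bilin M 0 = η + (2M/r) ℓ ⊗ ℓ`) is the
map `outMap M : x ↦ x + 2 torH(‖x̃‖) e₀` from outgoing to ingoing Kerr–Schild coordinates. This file proves:

* the **time reflection** `Θ v = v − 2v⁰ e₀` is a Lorentz transformation (`exists_timeReflection`);
* chart calculus for maps between open subsets of `E4` given in coordinates (`contMDiff_of_rep`,
  `mfderiv_apply_of_rep`);
* `D(outMap)(x) v = v + (4M/((r − 2M) r)) ⟪x̃, ṽ⟫ e₀` (`hasFDerivAt_outMap`, `fderiv_outMap_apply`) and the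
  classical identity behind the Eddington–Finkelstein coordinate change: the pullback of the ingoing form
  along `outMap` is the **outgoing** Kerr–Schild form, i.e. the ingoing form conjugated by `Θ`
  (`kerr_bilin_outMap_shift`, `pullback_outChart`);
* hence the deviation of the flat chart from the reflected Kerr background VANISHES identically
  (`deviation_outChart_eq_zero`), and by the multi-centre radiation-zone lemma its `Cᵏ` deviation from `η`
  on the slabs `{x⁰ = τ, ‖x̃‖ > ρ(τ)}` tends to `0` for any `ρ → ∞` (`tendsto_deviationCk_outChart`);
* `outMap` is injective and open on `{‖x̃‖ > 2M}` (`map_nhds_outMap`, `outMap_injOn`), so the flat chart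
  restricted to any open set is an open embedding (`isOpenEmbedding_restrict_outChart`).

References: Misner–Thorne–Wheeler 1973, §31.4 (ingoing/outgoing Eddington–Finkelstein forms
`ds² = −(1 − 2M/r) dt̃² ± (4M/r) dt̃ dr + (1 + 2M/r) dr² + r² dΩ²`); O'Neill 1983, Ch. 9 (Lorentz group).
-/

set_option linter.dupNamespace false

noncomputable section

open scoped Manifold ContDiff Topology RealInnerProductSpace
open Set Function Filter Literature.Geometry.Lorentzian

namespace Summit.FinalStateConjecture.FinalStateConjecture.Theorems.SwallowTheDatum.UniversalWitnessFamily

/-! ## The Minkowski form and the time reflection -/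

section Reflection

/-- `η(v, w) = −v⁰ w⁰ + ⟪ṽ, w̃⟫`. -/
theorem minkowski_eq (v w : E4) :
    Minkowski.bilin v w = -(v 0 * w 0) + ⟪E4.spatial v, E4.spatial w⟫ := by
  rw [Minkowski.bilin_apply]
  rw [show ⟪E4.spatial v, E4.spatial w⟫ = ∑ i : Fin 3, ⟪E4.spatial v i, E4.spatial w i⟫ from
    PiLp.inner_apply _ _]
  simp only [E4.spatial_apply, RCLike.inner_apply, conj_trivial]
  congr 1
  exact Finset.sum_congr rfl fun i _ ↦ by ring

/-- Time component of the reflected vector: `(Θ v)⁰ = −v⁰`. -/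
theorem reflect_apply_zero (v : E4) : (v - (2 * v 0) • E4.basisVector 0) 0 = -v 0 := by
  simp; ring

/-- The reflection does not change the spatial part. -/
theorem spatial_reflect (v : E4) : E4.spatial (v - (2 * v 0) • E4.basisVector 0) = E4.spatial v := by
  rw [sub_eq_add_neg, ← neg_smul, spatial_add_smul_basisVector]

/-- The reflection does not change the spatial radius. -/
theorem spatialNorm_reflect (v : E4) : E4.spatialNorm (v - (2 * v 0) • E4.basisVector 0) = E4.spatialNorm v := by
  unfold E4.spatialNorm; rw [spatial_reflect]

/-- The reflection is an involution. -/
theorem reflect_reflect (v : E4) :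
    (v - (2 * v 0) • E4.basisVector 0) - (2 * (v - (2 * v 0) • E4.basisVector 0) 0) • E4.basisVector 0 = v := by
  rw [reflect_apply_zero]
  module

/-- The reflection preserves `η`. -/
theorem minkowski_reflect (v w : E4) :
    Minkowski.bilin (v - (2 * v 0) • E4.basisVector 0) (w - (2 * w 0) • E4.basisVector 0) = Minkowski.bilin v w := by
  rw [minkowski_eq, minkowski_eq, reflect_apply_zero, reflect_apply_zero, spatial_reflect, spatial_reflect]
  ring

/-- **The time reflection `Θ v = v − 2v⁰ e₀` is a Lorentz transformation** (an element of `O(1,3)`, equal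
to its own inverse). -/
theorem exists_timeReflection :
    ∃ Θ : lorentzGroup, (∀ v : E4, (Θ : E4 ≃L[ℝ] E4) v = v - (2 * v 0) • E4.basisVector 0) ∧
      ∀ v : E4, (Θ : E4 ≃L[ℝ] E4).symm v = v - (2 * v 0) • E4.basisVector 0 := by
  set φ : E4 →L[ℝ] ℝ := (-2 : ℝ) • (EuclideanSpace.proj (0 : Fin 4) : E4 →L[ℝ] ℝ) with hφ
  have hφv : ∀ v : E4, φ v = -2 * v 0 := fun v ↦ by simp [hφ]
  have h1 : 1 + φ (E4.basisVector 0) ≠ 0 := by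
    rw [hφv, basisVector_zero_apply_zero]; norm_num
  have happ : ∀ v : E4, timeShiftEquiv φ h1 v = v - (2 * v 0) • E4.basisVector 0 := fun v ↦ by
    rw [timeShiftEquiv_apply, hφv, sub_eq_add_neg, ← neg_smul]
    congr 2
    ring
  have hmem : timeShiftEquiv φ h1 ∈ lorentzGroup := by
    rw [mem_lorentzGroup_iff]
    intro v w
    rw [happ, happ]
    exact minkowski_reflect v w
  refine ⟨⟨_, hmem⟩, happ, fun v ↦ ?_⟩
  have h2 : timeShiftEquiv φ h1 (v - (2 * v 0) • E4.basisVector 0) = v := by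
    rw [happ]; exact reflect_reflect v
  show (timeShiftEquiv φ h1).symm v = v - (2 * v 0) • E4.basisVector 0
  conv_lhs => rw [← h2]
  exact (timeShiftEquiv φ h1).symm_apply_apply _

end Reflection

/-! ## Chart calculus for maps between open subsets of `E4` given in coordinates -/

section Rep

variable {Ω V : TopologicalSpace.Opens E4}

/-- A map `Ψ : Ω → V` between open subsets of `E4` given in coordinates by `F` is `C^∞` if `F` is `C^∞` at
every point of `Ω`. -/
theorem contMDiff_of_rep (Ψ : Ω → V) (F : E4 → E4) (hΨ : ∀ y, (Ψ y : E4) = F y)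
    (hF : ∀ y : Ω, ContDiffAt ℝ ∞ F y) : ContMDiff 𝓘(ℝ, E4) 𝓘(ℝ, E4) ∞ Ψ := by
  have hval : ContMDiff 𝓘(ℝ, E4) 𝓘(ℝ, E4) ∞ (Subtype.val ∘ Ψ) := fun y ↦
    (OpensChart.contMDiffAt_iff y (Subtype.val ∘ Ψ) F hΨ).2 (hF y)
  exact (ContMDiff.subtypeVal_comp_iff V Ψ).1 hval

/-- The manifold derivative of a map `Ψ : Ω → V` given in coordinates by `F` (differentiable at `x`) is
`DF(x)`. -/
theorem mfderiv_apply_of_rep (Ψ : Ω → V) (F : E4 → E4) (hΨ : ∀ y, (Ψ y : E4) = F y) (x : Ω)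
    (hF : DifferentiableAt ℝ F x) (v : E4) :
    mfderiv 𝓘(ℝ, E4) 𝓘(ℝ, E4) Ψ x v = fderiv ℝ F x v := by
  have hrep : ∀ y : Ω, (Subtype.val ∘ Ψ) y = F y := hΨ
  have hd : MDifferentiableAt 𝓘(ℝ, E4) 𝓘(ℝ, E4) (Subtype.val ∘ Ψ) x :=
    (OpensChart.mdifferentiableAt_iff x (Subtype.val ∘ Ψ) F hrep).2 hF
  have h1 : mfderiv 𝓘(ℝ, E4) 𝓘(ℝ, E4) Ψ x = mfderiv 𝓘(ℝ, E4) 𝓘(ℝ, E4) (Subtype.val ∘ Ψ) x :=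
    OpensChart.mfderiv_codRestrict (f := Subtype.val ∘ Ψ) (φ := Ψ) (fun _ ↦ rfl) hd
  rw [h1, OpensChart.mfderiv_eq x (Subtype.val ∘ Ψ) F hrep hF]
  rfl

end Rep

/-! ## The Schwarzschild form, polarised; the outgoing form -/

section Forms

variable {M : ℝ}

/-- **The Schwarzschild Kerr–Schild form, polarised**: for `‖x̃‖ = r ≠ 0`,
`g_{M,0}(x)(v, w) = −v⁰w⁰ + ⟪ṽ, w̃⟫ + (2M/r)(v⁰ + ⟪x̃, ṽ⟫/r)(w⁰ + ⟪x̃, w̃⟫/r)`. -/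
theorem kerr_bilin_zero_spin {x : E4} (hx : E4.spatialNorm x ≠ 0) (v w : E4) :
    Kerr.bilin M 0 x v w = -(v 0 * w 0) + ⟪E4.spatial v, E4.spatial w⟫ +
      2 * M / E4.spatialNorm x * (v 0 + ⟪E4.spatial x, E4.spatial v⟫ / E4.spatialNorm x) *
        (w 0 + ⟪E4.spatial x, E4.spatial w⟫ / E4.spatialNorm x) := by
  rw [kerr_bilin_apply_eq, nullCovector_zero_spin_apply hx, nullCovector_zero_spin_apply hx,
    scalarH_zero_spin hx, minkowski_eq]
  ring

/-- **The outgoing Kerr–Schild form** (the ingoing one conjugated by the time reflection):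
`g_{M,0}(Θx)(Θv, Θw) = −v⁰w⁰ + ⟪ṽ, w̃⟫ + (2M/r)(−v⁰ + ⟪x̃, ṽ⟫/r)(−w⁰ + ⟪x̃, w̃⟫/r)`. -/
theorem kerr_bilin_reflect {x : E4} (hx : E4.spatialNorm x ≠ 0) (v w : E4) :
    Kerr.bilin M 0 (x - (2 * x 0) • E4.basisVector 0) (v - (2 * v 0) • E4.basisVector 0)
        (w - (2 * w 0) • E4.basisVector 0) =
      -(v 0 * w 0) + ⟪E4.spatial v, E4.spatial w⟫ +
        2 * M / E4.spatialNorm x * (-v 0 + ⟪E4.spatial x, E4.spatial v⟫ / E4.spatialNorm x) *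
          (-w 0 + ⟪E4.spatial x, E4.spatial w⟫ / E4.spatialNorm x) := by
  have hx' : E4.spatialNorm (x - (2 * x 0) • E4.basisVector 0) ≠ 0 := by rwa [spatialNorm_reflect]
  rw [kerr_bilin_zero_spin hx', reflect_apply_zero, reflect_apply_zero, spatial_reflect, spatial_reflect,
    spatial_reflect, spatialNorm_reflect]
  ring

/-- **The Eddington–Finkelstein identity**: with `β = 4M/(r − 2M)`, `s_v = ⟪x̃, ṽ⟫/r`,
`g_{M,0}(outMap x)(v + β s_v e₀, w + β s_w e₀) = g_{M,0}(Θx)(Θv, Θw)` — the pullback of the ingoing form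
along the outgoing-to-ingoing coordinate change is the outgoing form. -/
theorem kerr_bilin_outMap_shift (hM : 0 < M) {x : E4} (hx : 2 * M < E4.spatialNorm x) (v w : E4) :
    Kerr.bilin M 0 (outMap M x)
        (v + (4 * M / ((E4.spatialNorm x - 2 * M) * E4.spatialNorm x) * ⟪E4.spatial x, E4.spatial v⟫) •
          E4.basisVector 0)
        (w + (4 * M / ((E4.spatialNorm x - 2 * M) * E4.spatialNorm x) * ⟪E4.spatial x, E4.spatial w⟫) •
          E4.basisVector 0) =
      Kerr.bilin M 0 (x - (2 * x 0) • E4.basisVector 0) (v - (2 * v 0) • E4.basisVector 0)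
        (w - (2 * w 0) • E4.basisVector 0) := by
  have hr0 : E4.spatialNorm x ≠ 0 := by linarith
  have hr2 : E4.spatialNorm x - 2 * M ≠ 0 := by linarith
  have hr2' : E4.spatialNorm x - M * 2 ≠ 0 := by linarith
  have hxo : E4.spatialNorm (outMap M x) ≠ 0 := by rwa [spatialNorm_outMap]
  rw [kerr_bilin_zero_spin hxo, kerr_bilin_reflect hr0, spatialNorm_outMap, spatial_outMap,
    spatial_add_smul_basisVector, spatial_add_smul_basisVector]
  have h1 : ∀ (u : E4) (c : ℝ), (u + c • E4.basisVector 0) 0 = u 0 + c := fun u c ↦ by simp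
  rw [h1, h1]
  field_simp
  ring

end Forms

/-! ## The differential of `outMap` -/

section OutMap

variable {M : ℝ}

/-- The derivative of `outMap`: `D(outMap)(x) = id + (2 torH'(r) r⁻¹ ⟪x̃, ·̃⟫) ⊗ e₀`. -/
theorem hasFDerivAt_outMap (hM : 0 < M) {x : E4} (hx : 2 * M < E4.spatialNorm x) :
    HasFDerivAt (outMap M) (ContinuousLinearMap.id ℝ E4 +
      ((2 : ℝ) • ((2 * M / (E4.spatialNorm x - 2 * M)) •
        ((E4.spatialNorm x)⁻¹ • ((innerSL ℝ (E4.spatial x)).comp E4.spatial)))).smulRight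
        (E4.basisVector 0)) x := by
  have hx0 : E4.spatialNorm x ≠ 0 := by linarith
  have hg : HasFDerivAt (fun y : E4 ↦ 2 * torH M (E4.spatialNorm y))
      ((2 : ℝ) • ((2 * M / (E4.spatialNorm x - 2 * M)) •
        ((E4.spatialNorm x)⁻¹ • ((innerSL ℝ (E4.spatial x)).comp E4.spatial)))) x :=
    ((hasDerivAt_torH hM hx).comp_hasFDerivAt x (hasFDerivAt_spatialNorm hx0)).const_mul 2
  have : outMap M = fun y ↦ y + (2 * torH M (E4.spatialNorm y)) • E4.basisVector 0 := rfl
  rw [this]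
  exact (hasFDerivAt_id x).add (hg.smul_const (E4.basisVector 0))

/-- `outMap` is differentiable where `‖x̃‖ > 2M`. -/
theorem differentiableAt_outMap (hM : 0 < M) {x : E4} (hx : 2 * M < E4.spatialNorm x) :
    DifferentiableAt ℝ (outMap M) x :=
  (hasFDerivAt_outMap hM hx).differentiableAt

/-- **`D(outMap)(x) v = v + (4M/((r − 2M) r)) ⟪x̃, ṽ⟫ e₀`.** -/
theorem fderiv_outMap_apply (hM : 0 < M) {x : E4} (hx : 2 * M < E4.spatialNorm x) (v : E4) :
    fderiv ℝ (outMap M) x v =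
      v + (4 * M / ((E4.spatialNorm x - 2 * M) * E4.spatialNorm x) * ⟪E4.spatial x, E4.spatial v⟫) •
        E4.basisVector 0 := by
  have hx0 : E4.spatialNorm x ≠ 0 := by linarith
  have hr2 : E4.spatialNorm x - 2 * M ≠ 0 := by linarith
  have hr2' : E4.spatialNorm x - M * 2 ≠ 0 := by linarith
  rw [(hasFDerivAt_outMap hM hx).fderiv]
  simp only [FunLike.coe_add, Pi.add_apply, ContinuousLinearMap.id_apply,
    ContinuousLinearMap.smulRight_apply, FunLike.coe_smul, Pi.smul_apply, ContinuousLinearMap.comp_apply,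
    innerSL_apply_apply, smul_eq_mul]
  congr 2
  field_simp
  ring

/-- The `e₀`-derivative of the time shift `2 torH(‖x̃‖)` vanishes. -/
theorem fderiv_two_mul_torH_basisVector (hM : 0 < M) {x : E4} (hx : 2 * M < E4.spatialNorm x) :
    fderiv ℝ (fun y : E4 ↦ 2 * torH M (E4.spatialNorm y)) x (E4.basisVector 0) = 0 := by
  have hx0 : E4.spatialNorm x ≠ 0 := by linarith
  exact fderiv_comp_spatialNorm_basisVector (f := fun r ↦ 2 * torH M r) hx0
    ((hasDerivAt_torH hM hx).differentiableAt.const_mul 2)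

/-- **`outMap` maps neighbourhoods onto neighbourhoods** on `{‖x̃‖ > 2M}` (inverse function theorem; the
`e₀`-component of its differential is `1`). -/
theorem map_nhds_outMap (hM : 0 < M) {x : E4} (hx : 2 * M < E4.spatialNorm x) :
    map (outMap M) (𝓝 x) = 𝓝 (outMap M x) := by
  have hx0 : E4.spatialNorm x ≠ 0 := by linarith
  have hcd : ContDiffAt ℝ 1 (fun y : E4 ↦ 2 * torH M (E4.spatialNorm y)) x :=
    contDiffAt_const.mul ((contDiffAt_torH hM hx).comp x (contDiffAt_spatialNorm hx0))
  have hstrict := hcd.hasStrictFDerivAt one_ne_zero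
  have h1 : 1 + fderiv ℝ (fun y : E4 ↦ 2 * torH M (E4.spatialNorm y)) x (E4.basisVector 0) ≠ 0 := by
    rw [fderiv_two_mul_torH_basisVector hM hx]; norm_num
  exact map_nhds_timeShift hstrict h1

/-- Two points of `E4` with the same time coordinate and the same spatial part are equal. -/
theorem E4.ext_of_apply_zero_of_spatial {x y : E4} (h0 : x 0 = y 0) (hs : E4.spatial x = E4.spatial y) :
    x = y := by
  ext i
  refine Fin.cases h0 (fun j ↦ ?_) i
  have := congrArg (fun z : E3 ↦ z j) hs
  simpa [E4.spatial_apply] using this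

/-- **`outMap` is injective** (on all of `E4`): it preserves the spatial part, and then the time shift is
determined. -/
theorem outMap_injective (M : ℝ) : Injective (outMap M) := by
  intro x y hxy
  have hs : E4.spatial x = E4.spatial y := by
    rw [← spatial_outMap M x, ← spatial_outMap M y, hxy]
  have hn : E4.spatialNorm x = E4.spatialNorm y := by
    unfold E4.spatialNorm; rw [hs]
  have h0 : outMap M x 0 = outMap M y 0 := by rw [hxy]
  rw [outMap_apply_zero, outMap_apply_zero, hn] at h0
  exact E4.ext_of_apply_zero_of_spatial (by linarith) hs

/-- `outMap` lands in the Schwarzschild exterior when `‖x̃‖ > 2M`. -/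
theorem outMap_mem_region (hM : 0 < M) {x : E4} (hx : 2 * M < E4.spatialNorm x) :
    outMap M x ∈ Kerr.region 0 (Kerr.rPlus M 0) := by
  rw [mem_region_iff hM.le, spatialNorm_outMap]; exact hx

end OutMap

/-! ## The flat chart: smoothness, pullback, vanishing deviation, decay, embedding -/

section OutChart

variable {M : ℝ} {Ω : TopologicalSpace.Opens E4}

/-- The flat chart is `C^∞` (as a map of open submanifolds of `E4`). -/
theorem contMDiff_outChart (hM : 0 < M) (hΩ : ∀ x ∈ Ω, 2 * M < E4.spatialNorm x)
    (Ψ : Ω → Kerr.region 0 (Kerr.rPlus M 0)) (hΨ : ∀ y, (Ψ y : E4) = outMap M y) :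
    ContMDiff 𝓘(ℝ, E4) 𝓘(ℝ, E4) ∞ Ψ :=
  contMDiff_of_rep Ψ (outMap M) hΨ fun y ↦ contDiffAt_outMap hM (hΩ y.1 y.2)

/-- **Pullback of the Schwarzschild metric along the flat chart = the outgoing form**:
`g(Ψ x)(dΨ v, dΨ w) = g_{M,0}(Θx)(Θv, Θw)`. -/
theorem pullback_outChart [Kerr.Facts] (hM : 0 < M) (hΩ : ∀ x ∈ Ω, 2 * M < E4.spatialNorm x)
    (Ψ : Ω → Kerr.region 0 (Kerr.rPlus M 0)) (hΨ : ∀ y, (Ψ y : E4) = outMap M y) (x : Ω) (v w : E4) :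
    (Kerr.smoothMetric M 0 (Kerr.rPlus M 0)).val (Ψ x) (mfderiv 𝓘(ℝ, E4) 𝓘(ℝ, E4) Ψ x v)
        (mfderiv 𝓘(ℝ, E4) 𝓘(ℝ, E4) Ψ x w) =
      Kerr.bilin M 0 ((x : E4) - (2 * (x : E4) 0) • E4.basisVector 0) (v - (2 * v 0) • E4.basisVector 0)
        (w - (2 * w 0) • E4.basisVector 0) := by
  have hx := hΩ x.1 x.2
  rw [Kerr.smoothMetric_val, hΨ x, mfderiv_apply_of_rep Ψ (outMap M) hΨ x (differentiableAt_outMap hM hx),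
    mfderiv_apply_of_rep Ψ (outMap M) hΨ x (differentiableAt_outMap hM hx), fderiv_outMap_apply hM hx,
    fderiv_outMap_apply hM hx]
  exact kerr_bilin_outMap_shift hM hx v w

/-- **The deviation of the flat chart from the reflected Kerr background vanishes identically.** Here `B` is
any background with domain `Ω ⊆ {‖x̃‖ > 2M}` whose form is the boosted Kerr–Schild form with motion `(Θ, 0)`,
`Θ` the time reflection. -/
theorem deviation_outChart_eq_zero [Kerr.Facts] (hM : 0 < M) {Θ : lorentzGroup}
    (hΘs : ∀ v : E4, (Θ : E4 ≃L[ℝ] E4).symm v = v - (2 * v 0) • E4.basisVector 0)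
    (B : ModelBackground) (hBd : B.domain = Ω) (hBb : ∀ x, B.bilin x = boostedKerrBilin Θ 0 M 0 x)
    (hΩ : ∀ x ∈ Ω, 2 * M < E4.spatialNorm x)
    (Ψ : B.domain → Kerr.region 0 (Kerr.rPlus M 0)) (hΨ : ∀ y, (Ψ y : E4) = outMap M y) (x : B.domain) :
    (Kerr.spacetime M 0 (Kerr.rPlus M 0) hM.le).deviation B Ψ x = 0 := by
  subst hBd
  refine ContinuousLinearMap.ext fun v ↦ ContinuousLinearMap.ext fun w ↦ ?_
  rw [Spacetime.deviation_apply, hBb, boostedKerrBilin_apply, poincareInv, sub_zero, hΘs, hΘs,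
    hΘs]
  change (Kerr.smoothMetric M 0 (Kerr.rPlus M 0)).val (Ψ x) (mfderiv 𝓘(ℝ, E4) 𝓘(ℝ, E4) Ψ x v)
      (mfderiv 𝓘(ℝ, E4) 𝓘(ℝ, E4) Ψ x w) - _ = 0
  rw [pullback_outChart hM hΩ Ψ hΨ x v w, sub_self]

/-- Hence every `Cᵏ` slab deviation of the flat chart from the reflected Kerr background is `0`. -/
theorem deviationCk_outChart_eq_zero [Kerr.Facts] (hM : 0 < M) {Θ : lorentzGroup}
    (hΘs : ∀ v : E4, (Θ : E4 ≃L[ℝ] E4).symm v = v - (2 * v 0) • E4.basisVector 0)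
    (B : ModelBackground) (hBd : B.domain = Ω) (hBb : ∀ x, B.bilin x = boostedKerrBilin Θ 0 M 0 x)
    (hΩ : ∀ x ∈ Ω, 2 * M < E4.spatialNorm x)
    (Ψ : B.domain → Kerr.region 0 (Kerr.rPlus M 0)) (hΨ : ∀ y, (Ψ y : E4) = outMap M y) (k : ℕ) (τ : ℝ) :
    (Kerr.spacetime M 0 (Kerr.rPlus M 0) hM.le).deviationCk B Ψ k τ = 0 := by
  have hext : (Kerr.spacetime M 0 (Kerr.rPlus M 0) hM.le).deviationExtend B Ψ = 0 := by
    funext z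
    by_cases hz : z ∈ B.domain
    · rw [(Kerr.spacetime M 0 (Kerr.rPlus M 0) hM.le).deviationExtend_coe B Ψ ⟨z, hz⟩,
        deviation_outChart_eq_zero hM hΘs B hBd hBb hΩ Ψ hΨ ⟨z, hz⟩]
      rfl
    · rw [(Kerr.spacetime M 0 (Kerr.rPlus M 0) hM.le).deviationExtend_of_not_mem B Ψ hz]
      rfl
  unfold Spacetime.deviationCk
  rw [hext, supCkENorm_zero]

/-- **Radiation-zone decay of the flat chart.** If `W ⊆ Ω` is open and `ρ(z⁰) < ‖z̃‖` on `W` with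
`ρ → ∞`, the `Cᵏ` deviation of the flat chart from `η` on the slabs `{x⁰ = τ} ∩ W` tends to `0` (the
outgoing Kerr–Schild tail `(2M/r) ℓ_out ⊗ ℓ_out` and its derivatives are `O(1/r)`). -/
theorem tendsto_deviationCk_outChart [Kerr.Facts] (hM : 0 < M) {Θ : lorentzGroup}
    (hΘs : ∀ v : E4, (Θ : E4 ≃L[ℝ] E4).symm v = v - (2 * v 0) • E4.basisVector 0)
    (B : ModelBackground) (hBd : B.domain = Ω) (hBb : ∀ x, B.bilin x = boostedKerrBilin Θ 0 M 0 x)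
    (hBt : ∀ x, B.time x = x 0) (hΩ : ∀ x ∈ Ω, 2 * M < E4.spatialNorm x)
    (Ψ : B.domain → Kerr.region 0 (Kerr.rPlus M 0)) (hΨ : ∀ y, (Ψ y : E4) = outMap M y) (k : ℕ)
    {ρ : ℝ → ℝ} (hρ : Tendsto ρ atTop atTop) {W : TopologicalSpace.Opens E4}
    (hW : ∀ z ∈ W, ρ (z 0) < E4.spatialNorm z) (h : (Minkowski.backgroundOn W).domain ≤ B.domain) :
    Tendsto (fun τ ↦ (Kerr.spacetime M 0 (Kerr.rPlus M 0) hM.le).deviationCk (Minkowski.backgroundOn W)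
      (Ψ ∘ TopologicalSpace.Opens.inclusion h) k τ) atTop (𝓝 0) := by
  have hΨs : ContMDiff 𝓘(ℝ, E4) (𝓡 4) ∞ Ψ := by
    subst hBd; exact contMDiff_outChart hM hΩ Ψ hΨ
  have hBb' : ∀ x, B.bilin x - Minkowski.bilin =
      ∑ i : Fin 1, (boostedKerrBilin ((fun _ ↦ Θ) i) ((fun _ ↦ (0 : E4)) i) ((fun _ ↦ M) i)
        ((fun _ ↦ (0 : ℝ)) i) x - Minkowski.bilin) := fun x ↦ by
    rw [Fin.sum_univ_one, hBb]
  have ht : Tendsto (fun τ ↦ (Kerr.spacetime M 0 (Kerr.rPlus M 0) hM.le).deviationCk B Ψ k τ) atTop (𝓝 0) := by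
    have : (fun τ ↦ (Kerr.spacetime M 0 (Kerr.rPlus M 0) hM.le).deviationCk B Ψ k τ) = fun _ ↦ 0 :=
      funext fun τ ↦ deviationCk_outChart_eq_zero hM hΘs B hBd hBb hΩ Ψ hΨ k τ
    rw [this]; exact tendsto_const_nhds
  have hW' : ∀ z ∈ W, ∀ i : Fin 1, ρ (z 0) <
      Kerr.radius ((fun _ ↦ (0 : ℝ)) i) (poincareInv ((fun _ ↦ Θ) i) ((fun _ ↦ (0 : E4)) i) z) := by
    intro z hz _
    show ρ (z 0) < Kerr.radius 0 ((Θ : E4 ≃L[ℝ] E4).symm (z - 0))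
    rw [sub_zero, hΘs, Kerr.radius_zero_left, spatialNorm_reflect]
    exact hW z hz
  exact (Kerr.spacetime M 0 (Kerr.rPlus M 0) hM.le).tendsto_deviationCk_backgroundOn_multiCentre B hBb' hBt
    hΨs ht hρ hW' h

/-- **The flat chart restricted to an open subset is an open embedding** (`outMap` is injective and open on
`{‖x̃‖ > 2M}`). -/
theorem isOpenEmbedding_restrict_outChart (hM : 0 < M) (hΩ : ∀ x ∈ Ω, 2 * M < E4.spatialNorm x)
    (Ψ : Ω → Kerr.region 0 (Kerr.rPlus M 0)) (hΨ : ∀ y, (Ψ y : E4) = outMap M y) {L : Set Ω}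
    (hL : IsOpen L) : Topology.IsOpenEmbedding (L.restrict Ψ) :=
  isOpenEmbedding_restrict_of_coords Ψ (outMap M) hΨ hL (fun y _ ↦ map_nhds_outMap hM (hΩ y.1 y.2))
    fun _ _ _ _ h ↦ Subtype.ext (outMap_injective M h)

/-- Static time of the flat chart: `t(Ψ y) = y⁰ + torH(‖ỹ‖) ≥ y⁰` when `‖ỹ‖ ≥ 4M`. -/
theorem le_staticTime_outMap (hM : 0 < M) {y : E4} (hy : 4 * M ≤ E4.spatialNorm y) :
    y 0 ≤ staticTime M (outMap M y) := by
  rw [staticTime_outMap]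
  exact le_add_of_nonneg_right (torH_nonneg hM hy)

end OutChart

/-- **Anchor of part 7** (registered sub-goal of `stub_regionOneDecomposition`): the pullback of the ingoing
Schwarzschild Kerr–Schild form along `outMap` is the outgoing (time-reflected) form. -/
theorem regionOneFlatChart_anchor : ∀ (M : ℝ), 0 < M → ∀ x : E4, 2 * M < E4.spatialNorm x → ∀ v w : E4, Kerr.bilin M 0 (outMap M x) (fderiv ℝ (outMap M) x v) (fderiv ℝ (outMap M) x w) = Kerr.bilin M 0 (x - (2 * x 0) • E4.basisVector 0) (v - (2 * v 0) • E4.basisVector 0) (w - (2 * w 0) • E4.basisVector 0) := by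
  intro M hM x hx v w
  rw [fderiv_outMap_apply hM hx, fderiv_outMap_apply hM hx]
  exact kerr_bilin_outMap_shift hM hx v w

end Summit.FinalStateConjecture.FinalStateConjecture.Theorems.SwallowTheDatum.UniversalWitnessFamily

end
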